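import Literature.NumberTheory.Automorphic.SymplecticCartanIwasawaUniqueness
import Literature.NumberTheory.Automorphic.HyperspecialUnitaryHeckeTriangularProducts
import HarnessLib

/-!
# Products of Cartan double cosets of `Sp_{2n}` are unitriangular over EVERY commutative ring:
# `T_{d(a)} T_{d(b)} = T_{d(a+b)} + ∑_{ν < a+b} l_ν T_{d(ν)}` (Andrianov–Zhuravlev Ch. 3 §3; Macdonald Ch. V (2.6) for `GL_n`)

[topic NumberTheory/Automorphic] — lane `lit-hodgefound`, seat p11, generation 43, self-proposed theorem-only row g43-#7
(the `Sp_{2n}` analogue of `HyperspecialUnitaryHeckeTriangularProducts` (g43-#4) on top of the multiplicity-one theorem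
`SymplecticCartanIwasawaUniqueness` (g43-#6)).

## The print

`G = Sp_{2n}(K)` (`symplecticGroup (Fin n) K` for Mathlib's `J`), `K₀ = Sp_{2n}(𝒪)` (`symplecticInt`), Cartan representatives
`d(a) = diag(ϖ^{a}; ϖ^{-a})`, `a` antitone in `ℕⁿ` (`G = ⨆_a K₀ d(a) K₀`, Andrianov–Zhuravlev Ch. 3 §3 Lemma 3.6; tree:
`exists_antitone_mem_orbit`, `existsUnique_antitone_symplecticDivisors`), `T_{d(a)}` the double-coset operators — an
`R`-basis of `ℋ_R = ℋ(G, K₀; R)`.  Cartier [§IV, proof of Thm. 4.1 (c)]: the Satake transform is triangular for the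
dominance order with unit diagonal; for `Sp_{2n}` in the tree's conventions `𝒮_w(T_{d(a)}) = w(a) x^a + (terms x^μ, μ < a)`
(g43-#6 `coeff_self_satakeTransform_symplectic_cartanDiagonal`, Bruhat–Tits (4.4.4) (ii); `SymplecticIwasawaCartan`,
(4.4.4) (i)).  Consequently the multiplication table of `ℋ_R` in the basis `T_{d(a)}` is unitriangular:
`T_{d(a)} T_{d(b)} = T_{d(a+b)} + ∑_{ν < a+b} l_ν T_{d(ν)}` (Andrianov–Zhuravlev Ch. 3 §3.3, proof of Thm. 3.30; Macdonald
Ch. V (2.6) `c_λ c_μ = c_{λ+μ} + ∑_{ν<λ+μ} g^ν_{λμ} c_ν` for `GL_n`), over every commutative coefficient ring `R`.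

## What is formalised (kernel path: theorems only, no new definitions, no named facts)

`hϖ : v(ϖ) = exp(-1)`, `R` any commutative ring, `𝒮_w = (isIwasawaExponent_symplectic hϖ).satakeTransform w`, `𝒮_1` the
counting transform, `N = AddMonoidAlgebra.domCongr R R (AddEquiv.neg ℤⁿ)` the exponent-negation automorphism of `R[ℤⁿ]`.
* §1 TOPS VERSUS BOTTOMS: `(N f)_μ = f_{-μ}` (`coeff_domCongr_neg_apply`, `coeff_domCongr_neg_neg`); tops of `f` are bottoms
  of `N f` (`forall_sum_ite_lt_neg_le_of_coeff_domCongr_neg_ne_zero`); **top data multiply**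
  (`forall_headSum_le_and_coeff_mul_of_top`, from the bottom lemmas of `GLnSphericalHeckeAlgebraLeadingTerms` §1 through `N`).
* §2 TOP TERMS of `𝒮_w(T_{d(a)})`, any weight, any `R`: exponents `μ ≤ a`
  (`headSum_le_of_coeff_satakeTransform_symplectic_ne_zero`; the tree's version is the weight `q^{⟨ρ,·⟩}`), top data of
  `𝒮_1(T_{d(a)})` (`satakeTransform_one_top_data_symplectic`: coefficient `1` at `x^a`, g43-#6).
* §3 `T ∈ span_R {T_{d(a)}}` (`mem_span_doubleCosetOperator_antitone_symplectic`) and THE ENGINE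
  **`exists_finsupp_eq_sum_of_coeff_satakeTransform_one_symplectic`**: if `𝒮_1(T)` has exponents `≤ a₀` and coefficient `1`
  at `x^{a₀}` then `T = ∑_{a ≤ a₀} l_a T_{d(a)}` with `l_{a₀} = 1` (abstract support lemmas of
  `GLnSphericalHeckeAlgebraIntegralGenerators` §1 on the family `a ↦ N 𝒮_1(T_{d(a)})`).
* §4 PRODUCTS: `satakeTransform_one_mul_top_data_symplectic`, **`exists_finsupp_doubleCosetOperator_mul_eq_sum_symplectic`**
  (`T_{d(a)} T_{d(b)} = ∑_{ν ≤ a+b} l_ν T_{d(ν)}`, `l_{a+b} = 1`), **`doubleCosetOperator_mul_eq_add_sum_symplectic`** (leading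
  term split off), **`exists_finsupp_list_prod_doubleCosetOperator_eq_sum_symplectic`** (`∏ T_{d(a_k)} = T_{d(Σ a_k)} + lower`).
Commutativity of `ℋ_R` is in the tree (`isGelfandPair_symplecticInt`) and is not used here.  "Lower" is recorded by head
sums: `∑_{i<t} ν_i ≤ ∑_{i<t} (a+b)_i` for all `t`, with equality for all `t` iff `ν = a + b`.

## References
* [cite: AndrianovZhuravlev1995, Ch. 3 §3 Lemma 3.6; §3.3 Thm. 3.30 and its proof] — A. N. Andrianov, V. G. Zhuravlev,
  Modular forms and Hecke operators, Transl. Math. Monogr. 145, AMS 1995.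
* [cite: CartierCorvallis1979, §IV, Thm. 4.1, proof (c)] — P. Cartier, Representations of p-adic groups: a survey, Proc.
  Sympos. Pure Math. 33 (1979), part 1, 111–155.
* [cite: Macdonald1995, Ch. V (2.6); Ch. II (2.3)] — I. G. Macdonald, Symmetric functions and Hall polynomials, 2nd ed., 1995.
* [cite: BruhatTits1972, (4.4.3), (4.4.4)] — F. Bruhat, J. Tits, Groupes réductifs sur un corps local I, Publ. Math. IHÉS 41.
* [cite: ShimuraIATAF1971, Prop. 3.1] — G. Shimura, Introduction to the arithmetic theory of automorphic functions, 1971.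
-/

noncomputable section

open scoped Valued WithZero MatrixGroups
open Matrix MulAction MonoidAlgebra Finset

namespace Literature.NumberTheory.Automorphic.SymplecticCartan

open Literature.NumberTheory.Automorphic.CartanUnique Literature.NumberTheory.Automorphic.HermitianLattice

variable {K : Type*} [Field K] [Valued K ℤᵐ⁰] {ϖ : K} {n : ℕ} {R : Type*} [CommRing R]

/-! ## §1 Tops versus bottoms: the exponent-negation automorphism `x^μ ↦ x^{-μ}` of `R[ℤⁿ]` -/

omit [Valued K ℤᵐ⁰] in
/-- The coefficients of the exponent-negation twist: `(N f)_μ = f_{-μ}`. [cite: Macdonald1995, Ch. V (2.6)] -/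
theorem coeff_domCongr_neg_apply (f : AddMonoidAlgebra R (Fin n → ℤ)) (μ : Fin n → ℤ) :
    (AddMonoidAlgebra.domCongr R R (AddEquiv.neg (Fin n → ℤ)) f).coeff μ = f.coeff (fun j => -μ j) := by
  rw [AddMonoidAlgebra.coeff_domCongr, AddEquiv.neg_symm, AddEquiv.neg_apply]
  rfl

omit [Valued K ℤᵐ⁰] in
/-- `(N f)_{-a} = f_a`. [cite: Macdonald1995, Ch. V (2.6)] -/
theorem coeff_domCongr_neg_neg (f : AddMonoidAlgebra R (Fin n → ℤ)) (a : Fin n → ℤ) :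
    (AddMonoidAlgebra.domCongr R R (AddEquiv.neg (Fin n → ℤ)) f).coeff (fun j => -a j) = f.coeff a := by
  rw [coeff_domCongr_neg_apply]
  congr 1
  funext j
  simp only [neg_neg]

omit [Valued K ℤᵐ⁰] in
/-- **Tops become bottoms**: if every exponent of `f` is dominance-below `a`, every exponent of the twist `N f` is
dominance-above `-a`. [cite: Macdonald1995, Ch. V (2.6)] [cite: CartierCorvallis1979, §IV, proof of Thm. 4.1 (c)] -/
theorem forall_sum_ite_lt_neg_le_of_coeff_domCongr_neg_ne_zero {f : AddMonoidAlgebra R (Fin n → ℤ)} {a : Fin n → ℤ}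
    (hf : ∀ μ, f.coeff μ ≠ 0 → ∀ t : ℕ, (∑ i : Fin n, if (i : ℕ) < t then μ i else 0) ≤ ∑ i : Fin n, if (i : ℕ) < t then a i else 0)
    (μ : Fin n → ℤ) (hμ : (AddMonoidAlgebra.domCongr R R (AddEquiv.neg (Fin n → ℤ)) f).coeff μ ≠ 0) (t : ℕ) :
    (∑ i : Fin n, if (i : ℕ) < t then (fun j => -a j) i else 0) ≤ ∑ i : Fin n, if (i : ℕ) < t then μ i else 0 := by
  rw [coeff_domCongr_neg_apply] at hμ
  have h := hf (fun j => -μ j) hμ t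
  rw [sum_ite_lt_neg] at h ⊢
  exact neg_le.1 h

omit [Valued K ℤᵐ⁰] in
/-- **Top data multiply**: if every exponent of `f` (resp. `g`) is dominance-below `a` (resp. `b`) with coefficient `1`
at `x^a` (resp. `x^b`), then every exponent of `f g` is below `a + b` and the coefficient of `x^{a+b}` is `1` (the twist `N`
turns tops into bottoms, where `GLnSphericalHeckeAlgebraLeadingTerms` §1 applies). [cite: Macdonald1995, Ch. V (2.6)]
[cite: CartierCorvallis1979, §IV, proof of Thm. 4.1 (c)] -/
theorem forall_headSum_le_and_coeff_mul_of_top {f g : AddMonoidAlgebra R (Fin n → ℤ)} {a b : Fin n → ℤ}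
    (hf : (∀ μ, f.coeff μ ≠ 0 → ∀ t : ℕ, (∑ i : Fin n, if (i : ℕ) < t then μ i else 0) ≤ ∑ i : Fin n, if (i : ℕ) < t then a i else 0) ∧
      f.coeff a = 1)
    (hg : (∀ μ, g.coeff μ ≠ 0 → ∀ t : ℕ, (∑ i : Fin n, if (i : ℕ) < t then μ i else 0) ≤ ∑ i : Fin n, if (i : ℕ) < t then b i else 0) ∧
      g.coeff b = 1) :
    (∀ μ, (f * g).coeff μ ≠ 0 → ∀ t : ℕ, (∑ i : Fin n, if (i : ℕ) < t then μ i else 0) ≤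
        ∑ i : Fin n, if (i : ℕ) < t then (a + b) i else 0) ∧
      (f * g).coeff (a + b) = 1 := by
  have hf' := forall_sum_ite_lt_neg_le_of_coeff_domCongr_neg_ne_zero (R := R) hf.1
  have hg' := forall_sum_ite_lt_neg_le_of_coeff_domCongr_neg_ne_zero (R := R) hg.1
  refine ⟨fun μ hμ t => ?_, ?_⟩
  · rw [← coeff_domCongr_neg_neg _ μ, map_mul] at hμ
    have h := forall_sum_ite_lt_le_of_coeff_mul_ne_zero hf' hg' hμ t
    rw [← neg_add_eq_neg_add_neg, sum_ite_lt_neg, sum_ite_lt_neg, neg_le_neg_iff] at h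
    exact h
  · rw [← coeff_domCongr_neg_neg _ (a + b), map_mul, neg_add_eq_neg_add_neg,
      coeff_mul_add_eq_mul_coeff_of_forall_sum_ite_lt_le hf' hg', coeff_domCongr_neg_neg, coeff_domCongr_neg_neg, hf.2, hg.2,
      mul_one]

omit [Valued K ℤᵐ⁰] in
/-- The bottom `-(a + b)` of natural-number exponents, cast. [folklore] -/
private theorem neg_natCast_add (a b : Fin n → ℕ) :
    (fun j => -(((a + b) j : ℕ) : ℤ)) = fun j => -((fun i => (a i : ℤ)) + fun i => (b i : ℤ)) j := by
  funext j
  simp only [Pi.add_apply, Nat.cast_add]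

omit [Valued K ℤᵐ⁰] in
/-- The sum of a list of antitone exponents is antitone. [cite: BruhatTits1972, (4.4.3)] -/
theorem antitone_list_sum_nat (L : List {a : Fin n → ℕ // Antitone a}) : Antitone (L.map Subtype.val).sum := by
  induction L with
  | nil =>
    rw [List.map_nil, List.sum_nil]
    exact fun _ _ _ => le_rfl
  | cons a L ih =>
    rw [List.map_cons, List.sum_cons]
    exact fun i j hij => add_le_add (a.2 hij) (ih hij)

/-! ## §2 Top terms of `𝒮_w(T_{d(a)})`: exponents below `a`, coefficient `w(a)` at `x^a` -/

variable [IsHeckeTriple (⊤ : Submonoid (symplecticGroup (Fin n) K)) (symplecticInt (Fin n) K) (symplecticInt (Fin n) K)]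

/-- **`𝒮_w(T_{d(a)})` is triangular with top `a`** (`a` antitone, any weight, any commutative ring): every exponent `μ`
with non-zero coefficient satisfies `∑_{i<r} μ_i ≤ ∑_{i<r} a_i` (Bruhat–Tits (4.4.4) (i) through the coefficient formula;
the tree's `headSum_le_of_coeff_symplecticSatakeTransform_ne_zero` is the weight `q^{⟨ρ, ·⟩}`).
[cite: BruhatTits1972, Prop. (4.4.4) (i)] [cite: CartierCorvallis1979, §IV, proof of Thm. 4.1 (c)] -/
theorem headSum_le_of_coeff_satakeTransform_symplectic_ne_zero (hϖ : Valued.v ϖ = WithZero.exp (-1 : ℤ))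
    (w : Multiplicative (Fin n → ℤ) →* R) {a : Fin n → ℕ} (ha : Antitone a) {μ : Fin n → ℤ}
    (hμ : ((isIwasawaExponent_symplectic (n := n) hϖ).satakeTransform w
      (heckeAlgebra.doubleCosetOperator (symplecticInt (Fin n) K)
        (⟨Matrix.diagonal (Sum.elim (fun i => ϖ ^ a i) (fun i => (ϖ ^ a i)⁻¹)),
          diagonal_pow_mem_symplecticGroup (CartanUnique.uniformizer_ne_zero hϖ) a⟩ : symplecticGroup (Fin n) K))).coeff μ ≠ 0)
    (r : ℕ) :
    (∑ i : Fin n, if (i : ℕ) < r then μ i else 0) ≤ ∑ i : Fin n, if (i : ℕ) < r then (fun i => (a i : ℤ)) i else 0 := by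
  by_contra hlt
  refine hμ ((isIwasawaExponent_symplectic hϖ).coeff_satakeTransform_doubleCosetOperator_eq_zero _ fun γ hγ heq => ?_)
  have hγ' : (γ.out : symplecticGroup (Fin n) K ⧸ symplecticInt (Fin n) K) ∈ MulAction.orbit (symplecticInt (Fin n) K)
      (((⟨Matrix.diagonal (Sum.elim (fun i => ϖ ^ a i) (fun i => (ϖ ^ a i)⁻¹)),
          diagonal_pow_mem_symplecticGroup (CartanUnique.uniformizer_ne_zero hϖ) a⟩ : symplecticGroup (Fin n) K)) :
        symplecticGroup (Fin n) K ⧸ symplecticInt (Fin n) K) := by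
    rwa [QuotientGroup.out_eq']
  have h := sum_symplecticIwasawaExp_head_le hϖ ha hγ' r
  rw [heq, natCast_headSum] at h
  exact hlt h

/-- **Top data of `𝒮_1(T_{d(a)})`** (`a` antitone): exponents below `a`, coefficient `1` at `x^a` (g43-#6
`coeff_self_satakeTransform_symplectic_cartanDiagonal`). [cite: BruhatTits1972, Prop. (4.4.4) (i), (ii)] -/
theorem satakeTransform_one_top_data_symplectic (hϖ : Valued.v ϖ = WithZero.exp (-1 : ℤ)) {a : Fin n → ℕ}
    (ha : Antitone a) :
    (∀ μ, ((isIwasawaExponent_symplectic (n := n) hϖ).satakeTransform (1 : Multiplicative (Fin n → ℤ) →* R)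
        (heckeAlgebra.doubleCosetOperator (symplecticInt (Fin n) K)
          (⟨Matrix.diagonal (Sum.elim (fun i => ϖ ^ a i) (fun i => (ϖ ^ a i)⁻¹)),
            diagonal_pow_mem_symplecticGroup (CartanUnique.uniformizer_ne_zero hϖ) a⟩ : symplecticGroup (Fin n) K))).coeff μ ≠ 0 →
        ∀ t : ℕ, (∑ i : Fin n, if (i : ℕ) < t then μ i else 0) ≤ ∑ i : Fin n, if (i : ℕ) < t then (fun i => (a i : ℤ)) i else 0) ∧
      ((isIwasawaExponent_symplectic (n := n) hϖ).satakeTransform (1 : Multiplicative (Fin n → ℤ) →* R)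
        (heckeAlgebra.doubleCosetOperator (symplecticInt (Fin n) K)
          (⟨Matrix.diagonal (Sum.elim (fun i => ϖ ^ a i) (fun i => (ϖ ^ a i)⁻¹)),
            diagonal_pow_mem_symplecticGroup (CartanUnique.uniformizer_ne_zero hϖ) a⟩ : symplecticGroup (Fin n) K))).coeff
        (fun i => (a i : ℤ)) = 1 :=
  ⟨fun _ hμ t => headSum_le_of_coeff_satakeTransform_symplectic_ne_zero hϖ 1 ha hμ t, by
    rw [coeff_self_satakeTransform_symplectic_cartanDiagonal hϖ 1 ha, MonoidHom.one_apply]⟩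

/-! ## §3 Every `T` is a combination of the `T_{d(a)}`; THE ENGINE: the expansion of `T` from the top data of `𝒮_1(T)` -/

/-- **Every `T ∈ ℋ(Sp_{2n}(K), Sp_{2n}(𝒪); R)` is an `R`-combination of the `T_{d(a)}`, `a` antitone** (double-coset spanning
and the Cartan decomposition). [cite: AndrianovZhuravlev1995, Ch. 3 §3 Lemma 3.6] [cite: ShimuraIATAF1971, Prop. 3.1] -/
theorem mem_span_doubleCosetOperator_antitone_symplectic (hϖ : Valued.v ϖ = WithZero.exp (-1 : ℤ))
    (T : heckeAlgebra R (symplecticGroup (Fin n) K) (symplecticInt (Fin n) K)) :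
    T ∈ Submodule.span R (Set.range fun a : {a : Fin n → ℕ // Antitone a} =>
      heckeAlgebra.doubleCosetOperator (k := R) (symplecticInt (Fin n) K)
        (⟨Matrix.diagonal (Sum.elim (fun i => ϖ ^ a.1 i) (fun i => (ϖ ^ a.1 i)⁻¹)),
          diagonal_pow_mem_symplecticGroup (CartanUnique.uniformizer_ne_zero hϖ) a.1⟩ : symplecticGroup (Fin n) K)) := by
  refine (Submodule.span_le.2 ?_) (heckeAlgebra.mem_span_doubleCosetOperator (k := R) (symplecticInt (Fin n) K) T)
  rintro _ ⟨γ, -, rfl⟩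
  obtain ⟨a, ha, horb⟩ := exists_antitone_mem_orbit hϖ (γ.out : symplecticGroup (Fin n) K ⧸ symplecticInt (Fin n) K)
  rw [QuotientGroup.out_eq'] at horb
  have horb' : (γ.out : symplecticGroup (Fin n) K ⧸ symplecticInt (Fin n) K) ∈ MulAction.orbit (symplecticInt (Fin n) K)
      (((⟨Matrix.diagonal (Sum.elim (fun i => ϖ ^ a i) (fun i => (ϖ ^ a i)⁻¹)),
          diagonal_pow_mem_symplecticGroup (CartanUnique.uniformizer_ne_zero hϖ) a⟩ : symplecticGroup (Fin n) K)) :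
        symplecticGroup (Fin n) K ⧸ symplecticInt (Fin n) K) := by
    rw [QuotientGroup.out_eq', ← MulAction.orbit_eq_iff, MulAction.orbit_eq_iff.2 horb]
  change heckeAlgebra.doubleCosetOperator (k := R) (symplecticInt (Fin n) K) γ.out ∈ _
  rw [heckeAlgebra.doubleCosetOperator_eq_of_mem_orbit (symplecticInt (Fin n) K) horb']
  exact Submodule.subset_span ⟨⟨a, ha⟩, rfl⟩

/-- **THE ENGINE** (symplectic version of `exists_finsupp_eq_sum_of_coeff_satakeTransform_one`): if every exponent of the
counting transform `𝒮_1(T)` is dominance-below `a₀` (`a₀` antitone) and the coefficient of `x^{a₀}` is `1`, then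
`T = ∑_{a ≤ a₀} l_a T_{d(a)}` over antitone `a` dominance-below `a₀`, with `l_{a₀} = 1` — the abstract support lemmas of
`GLnSphericalHeckeAlgebraIntegralGenerators` §1 applied to the family `a ↦ N 𝒮_1(T_{d(a)})` (bottoms `-a`, bottom
coefficients `1`). [cite: CartierCorvallis1979, §IV, proof of Thm. 4.1 (c)] [cite: Macdonald1995, Ch. V (2.6)]
[cite: AndrianovZhuravlev1995, Ch. 3 §3 Lemma 3.6] -/
theorem exists_finsupp_eq_sum_of_coeff_satakeTransform_one_symplectic (hϖ : Valued.v ϖ = WithZero.exp (-1 : ℤ))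
    {T : heckeAlgebra R (symplecticGroup (Fin n) K) (symplecticInt (Fin n) K)} {a₀ : Fin n → ℕ} (ha₀ : Antitone a₀)
    (htri : ∀ μ, ((isIwasawaExponent_symplectic (n := n) hϖ).satakeTransform (1 : Multiplicative (Fin n → ℤ) →* R) T).coeff μ ≠ 0 →
      ∀ t : ℕ, (∑ i : Fin n, if (i : ℕ) < t then μ i else 0) ≤ ∑ i : Fin n, if (i : ℕ) < t then (fun i => (a₀ i : ℤ)) i else 0)
    (hlead : ((isIwasawaExponent_symplectic (n := n) hϖ).satakeTransform (1 : Multiplicative (Fin n → ℤ) →* R) T).coeff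
      (fun i => (a₀ i : ℤ)) = 1) :
    ∃ l : {a : Fin n → ℕ // Antitone a} →₀ R,
      (∀ a ∈ l.support, ∀ t : ℕ, (∑ i : Fin n, if (i : ℕ) < t then (fun i => ((a : Fin n → ℕ) i : ℤ)) i else 0) ≤
        ∑ i : Fin n, if (i : ℕ) < t then (fun i => (a₀ i : ℤ)) i else 0) ∧
      l ⟨a₀, ha₀⟩ = 1 ∧
      T = ∑ a ∈ l.support, l a • heckeAlgebra.doubleCosetOperator (k := R) (symplecticInt (Fin n) K)
        (⟨Matrix.diagonal (Sum.elim (fun i => ϖ ^ a.1 i) (fun i => (ϖ ^ a.1 i)⁻¹)),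
          diagonal_pow_mem_symplecticGroup (CartanUnique.uniformizer_ne_zero hϖ) a.1⟩ : symplecticGroup (Fin n) K) := by
  classical
  set S := (isIwasawaExponent_symplectic (n := n) hϖ).satakeTransform (1 : Multiplicative (Fin n → ℤ) →* R) with hS
  set Nw := AddMonoidAlgebra.domCongr R R (AddEquiv.neg (Fin n → ℤ)) with hNw
  set c : {a : Fin n → ℕ // Antitone a} → heckeAlgebra R (symplecticGroup (Fin n) K) (symplecticInt (Fin n) K) :=
    fun a => heckeAlgebra.doubleCosetOperator (k := R) (symplecticInt (Fin n) K)
      (⟨Matrix.diagonal (Sum.elim (fun i => ϖ ^ a.1 i) (fun i => (ϖ ^ a.1 i)⁻¹)),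
        diagonal_pow_mem_symplecticGroup (CartanUnique.uniformizer_ne_zero hϖ) a.1⟩ : symplecticGroup (Fin n) K) with hc
  obtain ⟨l, hlT⟩ := (Finsupp.mem_span_range_iff_exists_finsupp).1 (mem_span_doubleCosetOperator_antitone_symplectic (R := R) hϖ T)
  have hlT' : T = ∑ a ∈ l.support, l a • c a := by rw [← hlT, Finsupp.sum]
  have hST : (∑ a ∈ l.support, l a • Nw (S (c a))) = Nw (S T) := by
    rw [hlT', map_sum, map_sum]
    exact Finset.sum_congr rfl fun a _ => by rw [map_smul, map_smul]
  -- bottom data of the twisted family `a ↦ N 𝒮_1(c_a)`: bottoms `-a`, coefficient `1`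
  have hsupp : ∀ a ∈ insert (⟨a₀, ha₀⟩ : {a : Fin n → ℕ // Antitone a}) l.support, ∀ μ, (Nw (S (c a))).coeff μ ≠ 0 →
      ∀ t : ℕ, (∑ i : Fin n, if (i : ℕ) < t then (fun j => -(fun i => ((a : Fin n → ℕ) i : ℤ)) j) i else 0) ≤
        ∑ i : Fin n, if (i : ℕ) < t then μ i else 0 :=
    fun a _ μ hμ t => forall_sum_ite_lt_neg_le_of_coeff_domCongr_neg_ne_zero
      (satakeTransform_one_top_data_symplectic (R := R) hϖ a.2).1 μ hμ t
  have hlead' : ∀ a ∈ l.support, IsUnit ((Nw (S (c a))).coeff (fun j => -(fun i => ((a : Fin n → ℕ) i : ℤ)) j)) :=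
    fun a _ => by
      rw [coeff_domCongr_neg_neg, (satakeTransform_one_top_data_symplectic (R := R) hϖ a.2).2]
      exact isUnit_one
  have hinj : Set.InjOn (fun a : {a : Fin n → ℕ // Antitone a} => fun j => -(fun i => ((a : Fin n → ℕ) i : ℤ)) j)
      ↑(insert (⟨a₀, ha₀⟩ : {a : Fin n → ℕ // Antitone a}) l.support) :=
    fun a _ b _ h => Subtype.ext (funext fun j => by
      have hj := congrFun h j
      simp only [neg_inj, Nat.cast_inj] at hj
      exact hj)
  have hXtri : ∀ μ, (∑ a ∈ l.support, l a • Nw (S (c a))).coeff μ ≠ 0 →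
      ∀ t : ℕ, (∑ i : Fin n, if (i : ℕ) < t then (fun j => -(fun i => (a₀ i : ℤ)) j) i else 0) ≤
        ∑ i : Fin n, if (i : ℕ) < t then μ i else 0 := by
    rw [hST]
    exact fun μ hμ t => forall_sum_ite_lt_neg_le_of_coeff_domCongr_neg_ne_zero htri μ hμ t
  -- every `a` of the support has `-a` above `-a₀`, i.e. `a` below `a₀`
  have habove : ∀ a ∈ l.support, ∀ t : ℕ, (∑ i : Fin n, if (i : ℕ) < t then (fun j => -(fun i => (a₀ i : ℤ)) j) i else 0) ≤
      ∑ i : Fin n, if (i : ℕ) < t then (fun j => -(fun i => ((a : Fin n → ℕ) i : ℤ)) j) i else 0 := fun a ha t =>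
    forall_sum_ite_lt_le_of_coeff_sum_smul_ne_zero l.support (fun a => l a) (fun a => Nw (S (c a)))
      (fun a => fun j => -(fun i => ((a : Fin n → ℕ) i : ℤ)) j) (fun a ha b hb h => hinj (Finset.mem_insert_of_mem ha)
        (Finset.mem_insert_of_mem hb) h) (fun a ha => hsupp a (Finset.mem_insert_of_mem ha)) hlead'
      (fun j => -(fun i => (a₀ i : ℤ)) j) hXtri ha (Finsupp.mem_support_iff.1 ha) t
  -- the coefficient `l_{a₀}`
  have hsum' : (∑ a ∈ insert (⟨a₀, ha₀⟩ : {a : Fin n → ℕ // Antitone a}) l.support, l a • Nw (S (c a))) =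
      ∑ a ∈ l.support, l a • Nw (S (c a)) :=
    Finset.sum_insert_of_eq_zero_if_notMem fun h => by rw [Finsupp.notMem_support_iff.1 h, zero_smul]
  have hcoef := coeff_sum_smul_eq_mul_of_forall_le (insert (⟨a₀, ha₀⟩ : {a : Fin n → ℕ // Antitone a}) l.support)
    (fun a => l a) (fun a => Nw (S (c a))) (fun a => fun j => -(fun i => ((a : Fin n → ℕ) i : ℤ)) j) hinj hsupp
    (Finset.mem_insert_self _ _)
    (fun a ha _ t => by
      rcases Finset.mem_insert.1 ha with rfl | ha
      · exact le_rfl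
      · exact habove a ha t)
  rw [hsum', hST] at hcoef
  change (Nw (S T)).coeff (fun j => -(fun i => (a₀ i : ℤ)) j) =
    l ⟨a₀, ha₀⟩ * (Nw (S (c ⟨a₀, ha₀⟩))).coeff (fun j => -(fun i => (a₀ i : ℤ)) j) at hcoef
  rw [coeff_domCongr_neg_neg, coeff_domCongr_neg_neg, hlead, (satakeTransform_one_top_data_symplectic (R := R) hϖ ha₀).2,
    mul_one] at hcoef
  refine ⟨l, fun a ha t => ?_, hcoef.symm, hlT'⟩
  have h := habove a ha t
  rw [sum_ite_lt_neg, sum_ite_lt_neg, neg_le_neg_iff] at h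
  exact h

/-! ## §4 Products of Cartan double cosets are unitriangular -/

omit [Valued K ℤᵐ⁰] [IsHeckeTriple (⊤ : Submonoid (symplecticGroup (Fin n) K)) (symplecticInt (Fin n) K) (symplecticInt (Fin n) K)] in
/-- `d(0) = 1`. [folklore] -/
private theorem cartanDiagonal_zero (hϖ0 : ϖ ≠ 0) :
    ((⟨Matrix.diagonal (Sum.elim (fun i => ϖ ^ (0 : Fin n → ℕ) i) (fun i => (ϖ ^ (0 : Fin n → ℕ) i)⁻¹)),
        diagonal_pow_mem_symplecticGroup hϖ0 (0 : Fin n → ℕ)⟩ : symplecticGroup (Fin n) K)) = 1 := by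
  refine Subtype.ext ?_
  change Matrix.diagonal (Sum.elim (fun i => ϖ ^ (0 : Fin n → ℕ) i) (fun i => (ϖ ^ (0 : Fin n → ℕ) i)⁻¹)) = 1
  rw [← Matrix.diagonal_one]
  congr 1
  funext x
  rcases x with i | i <;> simp

omit [IsHeckeTriple (⊤ : Submonoid (symplecticGroup (Fin n) K)) (symplecticInt (Fin n) K) (symplecticInt (Fin n) K)] in
/-- **Top data multiply for the symplectic counting transform**: tops `a`, `b` with coefficient `1` give top `a + b` with
coefficient `1` for the product. [cite: Macdonald1995, Ch. V (2.6)] [cite: CartierCorvallis1979, §IV, proof of Thm. 4.1 (c)] -/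
theorem satakeTransform_one_mul_top_data_symplectic (hϖ : Valued.v ϖ = WithZero.exp (-1 : ℤ))
    {T₁ T₂ : heckeAlgebra R (symplecticGroup (Fin n) K) (symplecticInt (Fin n) K)} {a b : Fin n → ℕ}
    (h₁ : (∀ μ, ((isIwasawaExponent_symplectic (n := n) hϖ).satakeTransform (1 : Multiplicative (Fin n → ℤ) →* R) T₁).coeff μ ≠ 0 →
        ∀ t : ℕ, (∑ i : Fin n, if (i : ℕ) < t then μ i else 0) ≤ ∑ i : Fin n, if (i : ℕ) < t then (fun i => (a i : ℤ)) i else 0) ∧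
      ((isIwasawaExponent_symplectic (n := n) hϖ).satakeTransform (1 : Multiplicative (Fin n → ℤ) →* R) T₁).coeff
        (fun i => (a i : ℤ)) = 1)
    (h₂ : (∀ μ, ((isIwasawaExponent_symplectic (n := n) hϖ).satakeTransform (1 : Multiplicative (Fin n → ℤ) →* R) T₂).coeff μ ≠ 0 →
        ∀ t : ℕ, (∑ i : Fin n, if (i : ℕ) < t then μ i else 0) ≤ ∑ i : Fin n, if (i : ℕ) < t then (fun i => (b i : ℤ)) i else 0) ∧
      ((isIwasawaExponent_symplectic (n := n) hϖ).satakeTransform (1 : Multiplicative (Fin n → ℤ) →* R) T₂).coeff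
        (fun i => (b i : ℤ)) = 1) :
    (∀ μ, ((isIwasawaExponent_symplectic (n := n) hϖ).satakeTransform (1 : Multiplicative (Fin n → ℤ) →* R) (T₁ * T₂)).coeff μ ≠ 0 →
        ∀ t : ℕ, (∑ i : Fin n, if (i : ℕ) < t then μ i else 0) ≤
          ∑ i : Fin n, if (i : ℕ) < t then (fun i => (((a + b) i : ℕ) : ℤ)) i else 0) ∧
      ((isIwasawaExponent_symplectic (n := n) hϖ).satakeTransform (1 : Multiplicative (Fin n → ℤ) →* R) (T₁ * T₂)).coeff
        (fun i => (((a + b) i : ℕ) : ℤ)) = 1 := by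
  have hab : (fun i => (((a + b) i : ℕ) : ℤ)) = (fun i => (a i : ℤ)) + fun i => (b i : ℤ) := by
    funext i
    simp only [Pi.add_apply, Nat.cast_add]
  rw [map_mul, hab]
  exact forall_headSum_le_and_coeff_mul_of_top h₁ h₂

/-- **PRODUCTS OF CARTAN DOUBLE COSETS OF `Sp_{2n}` ARE UNITRIANGULAR, OVER ANY COMMUTATIVE RING `R`**: for antitone
`a, b ∈ ℕⁿ`, `T_{d(a)} T_{d(b)} = ∑_ν l_ν T_{d(ν)}` over antitone `ν ≤ a + b` (dominance) with `l_{a+b} = 1` — the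
symplectic case of Cartier's step (c); Andrianov–Zhuravlev's triangularity of the multiplication table of the local Hecke
ring of `Sp_n`; Macdonald's `c_λ c_μ = c_{λ+μ} + ∑_{ν<λ+μ} g^ν_{λμ} c_ν` for `GL_n`.
[cite: CartierCorvallis1979, §IV, proof of Thm. 4.1 (c)] [cite: AndrianovZhuravlev1995, Ch. 3 §3 Lemma 3.6, §3.3 Thm. 3.30]
[cite: Macdonald1995, Ch. V (2.6)] -/
theorem exists_finsupp_doubleCosetOperator_mul_eq_sum_symplectic (hϖ : Valued.v ϖ = WithZero.exp (-1 : ℤ)) {a b : Fin n → ℕ}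
    (ha : Antitone a) (hb : Antitone b) :
    ∃ l : {a : Fin n → ℕ // Antitone a} →₀ R,
      (∀ ν ∈ l.support, ∀ t : ℕ, (∑ i : Fin n, if (i : ℕ) < t then (fun i => ((ν : Fin n → ℕ) i : ℤ)) i else 0) ≤
        ∑ i : Fin n, if (i : ℕ) < t then (fun i => (((a + b) i : ℕ) : ℤ)) i else 0) ∧
      l ⟨a + b, ha.add hb⟩ = 1 ∧
      heckeAlgebra.doubleCosetOperator (k := R) (symplecticInt (Fin n) K)
            (⟨Matrix.diagonal (Sum.elim (fun i => ϖ ^ a i) (fun i => (ϖ ^ a i)⁻¹)),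
              diagonal_pow_mem_symplecticGroup (CartanUnique.uniformizer_ne_zero hϖ) a⟩ : symplecticGroup (Fin n) K) *
          heckeAlgebra.doubleCosetOperator (k := R) (symplecticInt (Fin n) K)
            (⟨Matrix.diagonal (Sum.elim (fun i => ϖ ^ b i) (fun i => (ϖ ^ b i)⁻¹)),
              diagonal_pow_mem_symplecticGroup (CartanUnique.uniformizer_ne_zero hϖ) b⟩ : symplecticGroup (Fin n) K) =
        ∑ ν ∈ l.support, l ν • heckeAlgebra.doubleCosetOperator (k := R) (symplecticInt (Fin n) K)
          (⟨Matrix.diagonal (Sum.elim (fun i => ϖ ^ ν.1 i) (fun i => (ϖ ^ ν.1 i)⁻¹)),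
            diagonal_pow_mem_symplecticGroup (CartanUnique.uniformizer_ne_zero hϖ) ν.1⟩ : symplecticGroup (Fin n) K) := by
  obtain ⟨htri, hlead⟩ := satakeTransform_one_mul_top_data_symplectic hϖ (satakeTransform_one_top_data_symplectic (R := R) hϖ ha)
    (satakeTransform_one_top_data_symplectic (R := R) hϖ hb)
  exact exists_finsupp_eq_sum_of_coeff_satakeTransform_one_symplectic hϖ (ha.add hb) htri hlead

/-- **`T_{d(a)} T_{d(b)} = T_{d(a+b)} + ∑_{ν ≠ a+b, ν ≤ a+b} l_ν T_{d(ν)}`**: the leading term split off (any `R`).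
[cite: CartierCorvallis1979, §IV, proof of Thm. 4.1 (c)] [cite: AndrianovZhuravlev1995, Ch. 3 §3.3 Thm. 3.30] -/
theorem doubleCosetOperator_mul_eq_add_sum_symplectic (hϖ : Valued.v ϖ = WithZero.exp (-1 : ℤ)) {a b : Fin n → ℕ}
    (ha : Antitone a) (hb : Antitone b) :
    ∃ l : {a : Fin n → ℕ // Antitone a} →₀ R,
      (∀ ν ∈ l.support.erase ⟨a + b, ha.add hb⟩, (ν : Fin n → ℕ) ≠ a + b ∧
        ∀ t : ℕ, (∑ i : Fin n, if (i : ℕ) < t then (fun i => ((ν : Fin n → ℕ) i : ℤ)) i else 0) ≤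
          ∑ i : Fin n, if (i : ℕ) < t then (fun i => (((a + b) i : ℕ) : ℤ)) i else 0) ∧
      heckeAlgebra.doubleCosetOperator (k := R) (symplecticInt (Fin n) K)
            (⟨Matrix.diagonal (Sum.elim (fun i => ϖ ^ a i) (fun i => (ϖ ^ a i)⁻¹)),
              diagonal_pow_mem_symplecticGroup (CartanUnique.uniformizer_ne_zero hϖ) a⟩ : symplecticGroup (Fin n) K) *
          heckeAlgebra.doubleCosetOperator (k := R) (symplecticInt (Fin n) K)
            (⟨Matrix.diagonal (Sum.elim (fun i => ϖ ^ b i) (fun i => (ϖ ^ b i)⁻¹)),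
              diagonal_pow_mem_symplecticGroup (CartanUnique.uniformizer_ne_zero hϖ) b⟩ : symplecticGroup (Fin n) K) =
        heckeAlgebra.doubleCosetOperator (k := R) (symplecticInt (Fin n) K)
            (⟨Matrix.diagonal (Sum.elim (fun i => ϖ ^ (a + b) i) (fun i => (ϖ ^ (a + b) i)⁻¹)),
              diagonal_pow_mem_symplecticGroup (CartanUnique.uniformizer_ne_zero hϖ) (a + b)⟩ : symplecticGroup (Fin n) K) +
          ∑ ν ∈ l.support.erase ⟨a + b, ha.add hb⟩, l ν •
            heckeAlgebra.doubleCosetOperator (k := R) (symplecticInt (Fin n) K)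
              (⟨Matrix.diagonal (Sum.elim (fun i => ϖ ^ ν.1 i) (fun i => (ϖ ^ ν.1 i)⁻¹)),
                diagonal_pow_mem_symplecticGroup (CartanUnique.uniformizer_ne_zero hϖ) ν.1⟩ : symplecticGroup (Fin n) K) := by
  classical
  obtain ⟨l, hl, hla, hprod⟩ := exists_finsupp_doubleCosetOperator_mul_eq_sum_symplectic (R := R) hϖ ha hb
  refine ⟨l, fun ν hν => ?_, ?_⟩
  · obtain ⟨hne, hν⟩ := Finset.mem_erase.1 hν
    exact ⟨fun h => hne (Subtype.ext h), hl ν hν⟩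
  · rw [hprod]
    by_cases hmem : (⟨a + b, ha.add hb⟩ : {a : Fin n → ℕ // Antitone a}) ∈ l.support
    · rw [← Finset.add_sum_erase _ _ hmem, hla, one_smul]
    · have h0 : l ⟨a + b, ha.add hb⟩ = 0 := Finsupp.notMem_support_iff.1 hmem
      rw [hla] at h0
      have hR : ∀ x : heckeAlgebra R (symplecticGroup (Fin n) K) (symplecticInt (Fin n) K), x = 0 := fun x => by
        rw [← one_smul R x, h0, zero_smul]
      rw [hR (∑ ν ∈ l.support, _), hR (_ + _)]

/-- **A PRODUCT `T_{d(a_1)} ⋯ T_{d(a_m)}` IS `T_{d(a_1 + ⋯ + a_m)} +` LOWER TERMS** (any `R`): for a list of antitone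
exponents, `∏ T_{d(a_k)} = ∑_ν l_ν T_{d(ν)}` with `l_{Σ a_k} = 1` and every `ν` of the support `≤ Σ a_k`.
[cite: AndrianovZhuravlev1995, Ch. 3 §3.3 Thm. 3.30] [cite: Macdonald1995, Ch. II (2.3), Ch. V (2.6)] -/
theorem exists_finsupp_list_prod_doubleCosetOperator_eq_sum_symplectic (hϖ : Valued.v ϖ = WithZero.exp (-1 : ℤ))
    (L : List {a : Fin n → ℕ // Antitone a}) :
    ∃ l : {a : Fin n → ℕ // Antitone a} →₀ R,
      (∀ ν ∈ l.support, ∀ t : ℕ, (∑ i : Fin n, if (i : ℕ) < t then (fun i => ((ν : Fin n → ℕ) i : ℤ)) i else 0) ≤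
        ∑ i : Fin n, if (i : ℕ) < t then (fun i => (((L.map Subtype.val).sum i : ℕ) : ℤ)) i else 0) ∧
      l ⟨(L.map Subtype.val).sum, antitone_list_sum_nat L⟩ = 1 ∧
      (L.map fun a : {a : Fin n → ℕ // Antitone a} => heckeAlgebra.doubleCosetOperator (k := R) (symplecticInt (Fin n) K)
          (⟨Matrix.diagonal (Sum.elim (fun i => ϖ ^ a.1 i) (fun i => (ϖ ^ a.1 i)⁻¹)),
            diagonal_pow_mem_symplecticGroup (CartanUnique.uniformizer_ne_zero hϖ) a.1⟩ : symplecticGroup (Fin n) K)).prod =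
        ∑ ν ∈ l.support, l ν • heckeAlgebra.doubleCosetOperator (k := R) (symplecticInt (Fin n) K)
          (⟨Matrix.diagonal (Sum.elim (fun i => ϖ ^ ν.1 i) (fun i => (ϖ ^ ν.1 i)⁻¹)),
            diagonal_pow_mem_symplecticGroup (CartanUnique.uniformizer_ne_zero hϖ) ν.1⟩ : symplecticGroup (Fin n) K) := by
  -- top data of the product, by induction on the list
  have hdata : ∀ L : List {a : Fin n → ℕ // Antitone a},
      (∀ μ, ((isIwasawaExponent_symplectic (n := n) hϖ).satakeTransform (1 : Multiplicative (Fin n → ℤ) →* R)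
          (L.map fun a : {a : Fin n → ℕ // Antitone a} => heckeAlgebra.doubleCosetOperator (k := R) (symplecticInt (Fin n) K)
            (⟨Matrix.diagonal (Sum.elim (fun i => ϖ ^ a.1 i) (fun i => (ϖ ^ a.1 i)⁻¹)),
              diagonal_pow_mem_symplecticGroup (CartanUnique.uniformizer_ne_zero hϖ) a.1⟩ : symplecticGroup (Fin n) K)).prod).coeff μ ≠ 0 →
        ∀ t : ℕ, (∑ i : Fin n, if (i : ℕ) < t then μ i else 0) ≤
          ∑ i : Fin n, if (i : ℕ) < t then (fun i => (((L.map Subtype.val).sum i : ℕ) : ℤ)) i else 0) ∧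
      ((isIwasawaExponent_symplectic (n := n) hϖ).satakeTransform (1 : Multiplicative (Fin n → ℤ) →* R)
          (L.map fun a : {a : Fin n → ℕ // Antitone a} => heckeAlgebra.doubleCosetOperator (k := R) (symplecticInt (Fin n) K)
            (⟨Matrix.diagonal (Sum.elim (fun i => ϖ ^ a.1 i) (fun i => (ϖ ^ a.1 i)⁻¹)),
              diagonal_pow_mem_symplecticGroup (CartanUnique.uniformizer_ne_zero hϖ) a.1⟩ : symplecticGroup (Fin n) K)).prod).coeff
        (fun i => (((L.map Subtype.val).sum i : ℕ) : ℤ)) = 1 := by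
    intro L
    induction L with
    | nil =>
      have h := satakeTransform_one_top_data_symplectic (R := R) hϖ (show Antitone (0 : Fin n → ℕ) from fun _ _ _ => le_rfl)
      rw [cartanDiagonal_zero (CartanUnique.uniformizer_ne_zero hϖ), heckeAlgebra.doubleCosetOperator_one] at h
      rw [List.map_nil, List.prod_nil, List.map_nil, List.sum_nil]
      exact h
    | cons a L ih =>
      rw [List.map_cons, List.prod_cons, List.map_cons, List.sum_cons]
      exact satakeTransform_one_mul_top_data_symplectic hϖ (satakeTransform_one_top_data_symplectic (R := R) hϖ a.2) ih
  obtain ⟨htri, hlead⟩ := hdata L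
  exact exists_finsupp_eq_sum_of_coeff_satakeTransform_one_symplectic hϖ (antitone_list_sum_nat L) htri hlead

end Literature.NumberTheory.Automorphic.SymplecticCartan

end
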